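import Literature.MathematicalPhysics.QuantumFieldTheory.Balaban1983to89.B1Eq324BenfattoKernelSect5UpperAssembly
import Literature.MathematicalPhysics.QuantumFieldTheory.Balaban1983to89.B1Eq324BenfattoKernelSect5LedgerBridgeUpper
import Literature.MathematicalPhysics.QuantumFieldTheory.Balaban1983to89.B1Eq324BenfattoKernelSect5ChainGeometry
import Literature.MathematicalPhysics.QuantumFieldTheory.Balaban1983to89.B1Eq324BenfattoSpecialisation
import HarnessLib

/-!
# `Balaban1983to89.B1Eq324BenfattoKernelSect5Ineq46Class` — (4.6) FOR EVERY MEMBER OF THE CLASS, nI-FORM, from the UPPER LEDGER PACK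
([BenfattoEtAl1978] Basic Lemma (4.6) p. 152 «∫Π_Δχ̂_Δ e^{H_J} P̄(dz) ≤ exp(Σ ε^T/n! + |I|·ε(A,b,t))», `P̄ = P̂₀(·|z̄ on C)`, over the class of
[Balaban1985BackgroundPropagators] Sect. E) — the mirror of seat n08-b's `…KernelSect5Ineq47Class`

statement-level skeleton of published theorems with citation tags; proofs where landed; nothing here is a claim about the
Yang–Mills mass gap

WHY THIS MODULE (cell `pub-ymgap`, seat `dag-n08-c` gen 32, conditional CLAIM-21 (n08-b W1 lane, taken over by the (4.6) author to unblock the ∃-knit);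
node N08 [Balaban1985UV3]; the [BenfattoEtAl1978] source chain behind the (α)-row `h324`).  The PER-MEMBER, PER-INSTANCE (4.6): for a class member on its
finite window `Λ`, a datum `J ⊆ I`, a conditioning set `C ⊆ Λ` Euclidean-far from `J`, the pavement `(L, w, v)` and the nI-form upper ledger clause of
seat n08-b's `…KernelSect5LedgerDischargeUpper.upperpack_class` at `b`, read at `nI := |I|`: the conditioned (4.6)-integral at cut-off `b` is
`≤ exp(cumulantSum μ_K H^𝔄_J t + |I|·errTerm S ρ 𝔄 b t)`.  Assembled exactly like `ineq47_class_of_pack` (whose text this file mirrors line by line):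
clip `𝔄` to `J` (`…Sect5PavementChain.exists_coefSupportedIn_clip`), print's chain by `Nat.rec` with the constant diagonal displacements
`τ_k ≡ −2(2w+v)·𝟙`, GROWING cut-offs `b_k = b/γ^{k+1}` (`γb_0 = b`), drifting conditioning data `C_{k+1} = C_k + τ_k`, `z̄_{k+1} = z̄_k∘(·−τ_k)`, the
stopping index `m ≤ d + 1` (n08-d `exists_stoppingIndex` + my `sep_of_constDiagonal`), frames / conditioning containment / parts / far rows by my
`…KernelSect5ChainGeometry` from the padding of `J` and the original-frame far hypothesis at `R = b³`, part kernels and letters by definition, n08-b's bridge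
`…LedgerBridgeUpper.ledger_geometric_le_nI_upper` fed with the pack clause at `n := m`, then my knit `…UpperAssembly.integral_condFieldK_le_exp_cumulantSum_add_of_ledger`.

WHAT IS PROVED (theorems only; no definition, no named fact, no `sorry`; axioms standard).
* ★★★ `ineq46_class_of_pack` — (4.6) for every member, nI-form, from the upper pack clause (statement shape = `ineq47_class_of_pack`'s with the upper
  letters: `hsmallU` at `R = b³`, `1 ≤ b`, `L^d e^{−b²/4} ≤ 1/6`, `C ⊆ Λ`, `hCfar0`, `z̄`; minus `I ≠ ∅`).

HONEST SCOPE / NOT HERE.  The threshold `b*`, the choice of `γ`, `S`, `ρ` and the signed Lemma are `…KernelSect5ClassBasicLemma` (next); the class is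
OURS; one self-located piece of an UNCOMMISSIONED port; nothing of [Balaban1985UV3] / [Balaban1985UV2] is asserted; count-neutral for N08; nothing about
d = 4, the continuum, OS axioms, a mass gap or the Clay problem.
-/

noncomputable section

open MeasureTheory ProbabilityTheory Finset Matrix
open scoped BigOperators Nat NNReal

namespace Literature.MathematicalPhysics.QuantumFieldTheory.Balaban1983to89.B1Eq324BenfattoKernelSect5Ineq46Class

open _root_.MeasureTheory _root_.ProbabilityTheory
open Literature.Probability.LatticeModels (setPartitions)
open Literature.MathematicalPhysics.QuantumFieldTheory
open Literature.MathematicalPhysics.QuantumFieldTheory.Balaban1983to89.B1Eq324BenfattoLemma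
open Literature.MathematicalPhysics.QuantumFieldTheory.Balaban1983to89.B1Eq324BenfattoSect5Boxes
open Literature.MathematicalPhysics.QuantumFieldTheory.Balaban1983to89.B1Eq324BenfattoSect5Eq511
open Literature.MathematicalPhysics.QuantumFieldTheory.Balaban1983to89.B1Eq324BenfattoSect5Eq524
open Literature.MathematicalPhysics.QuantumFieldTheory.Balaban1983to89.B1Eq324BenfattoSect5Eq534
open Literature.MathematicalPhysics.QuantumFieldTheory.Balaban1983to89.B1Eq324BenfattoSect5Eq515
open Literature.MathematicalPhysics.QuantumFieldTheory.Balaban1983to89.B1Eq324BenfattoSect5Iteration (restrictCoef shiftCoef)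
open Literature.MathematicalPhysics.QuantumFieldTheory.Balaban1983to89.B1Eq324BenfattoSpecialisation (coefSup_nonneg)
open Literature.MathematicalPhysics.QuantumFieldTheory.Balaban1983to89.B1Eq324BenfattoKernelSect5Iteration (mem_image_sub_iff)
open Literature.MathematicalPhysics.QuantumFieldTheory.Balaban1983to89.B1Eq324BenfattoSect5PavementChain
  (chain_invariants exists_coefSupportedIn_clip)
open Literature.MathematicalPhysics.QuantumFieldTheory.Balaban1983to89.B1Eq324BenfattoKernelSect5PavementChain (exists_stoppingIndex)
open Literature.MathematicalPhysics.QuantumFieldTheory.Balaban1983to89.B1Eq324BenfattoSect5CollectErrors (card_chain_le)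
open Literature.MathematicalPhysics.QuantumFieldTheory.Balaban1983to89.B1Eq324BenfattoKernelSect5ChainGeometry
  (boxes_subset_frame_of_pad corridors_subset_frame_of_pad conditioning_subset_frame disjoint_shrink_conditioning_of_far far_conditioning_of_far
  sep_of_constDiagonal)
open Literature.MathematicalPhysics.QuantumFieldTheory.Balaban1983to89.B1Eq324BenfattoKernelSect5UpperAssembly
  (integral_condFieldK_le_exp_cumulantSum_add_of_ledger)
open Literature.MathematicalPhysics.QuantumFieldTheory.Balaban1983to89.B1Eq324BenfattoKernelSect5LedgerBridgeUpper (ledger_geometric_le_nI_upper)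
open Literature.MathematicalPhysics.QuantumFieldTheory.Balaban1983to89.B1Eq324BenfattoKernelSect5LedgerDischargeLower (K0_ties)
open Literature.MathematicalPhysics.QuantumFieldTheory.Balaban1983to89.B1Eq324GaussianMomentLeaf (momentConst)

variable {d : ℕ}

section Member

variable {Λ : Finset (B1Eq324BenfattoLemma.Site d)} {A : Matrix Λ Λ ℝ}
  {K : B1Eq324BenfattoLemma.Site d → B1Eq324BenfattoLemma.Site d → ℝ}
  (hK : ∀ x y, K x y = if h : x ∈ Λ ∧ y ∈ Λ then (A⁻¹ : Matrix Λ Λ ℝ) ⟨x, h.1⟩ ⟨y, h.2⟩ else 0)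

include hK

set_option maxHeartbeats 1600000 in -- the ≈ 100-line closed nI-form ledger in the statement (elaboration alone exceeds the default), as in `…Ineq47Class`
/-- ★★★ **(4.6) FOR EVERY MEMBER OF THE CLASS, nI-FORM** — for a class member `(Λ, A, K)` (`Λ ≠ ∅`; `A` symmetric `γ_A`-coercive; Euclidean
Combes–Thomas row `J_c < γ_A` at rate `θ`; rows `V, M, V₂, M₂, V₄`; `1/γ_A ≤ 1/2`), a scheme `ϰ > 0`, `0 < γ ≤ 1` with the upper centre row
`M₂V₄/(γ_A−J_c)·(γ + e^{−θb³/4}) ≤ 1/2`, a rate `0 < δ ≤ θ/√d` with `δD²√d < ϰ`, the pavement side of `upperpack_class` at `b` (`2(2w+v) < L`,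
`(d+1)·2(2w+v) ≤ L`, `v ≤ w`, `1 ≤ w`, `1 ≤ b`, `L^d e^{−b²/4} ≤ 1/6`, guard, width rows), data `J ⊆ I` (no `I ≠ ∅` and no `w − v ≤ b³` needed on
this side: no Appendix A, and `ε₃₁` is displayed with both depth terms), `𝔄` with `A_c = coefSup s D 𝔄 J`,
the padding of `J` in `Λ` at sup-radius `L`, a conditioning set `C ⊆ Λ` with `|x − c|₂ ≥ b³ + √d·L` (`x ∈ J`, `c ∈ C`), ANY conditioning values `z̄`, and the
nI-form upper ledger at `nI := |I|`, `A := A_c` for every `n ≤ d + 1`: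
`∫Π_Δχ̂^I_b e^{H^𝔄_J} dP̄^K_{C,z̄} ≤ exp(cumulantSum μ_K H^𝔄_J t + |I|·errTerm S ρ₁ ρ₂ ρ₃ ρ₄ A_c b t)`.
[cite: BenfattoEtAl1978, Basic Lemma (4.6) p.152; §5 (5.36) p.159 «In this case also we get (4.6)»; Balaban1985BackgroundPropagators, (1.16)–(1.18) p.180, Sect. E p.428 (class form; ours)] -/
theorem ineq46_class_of_pack (hΛ : Λ.Nonempty)
    (hAs : ∀ e e', A e e' = A e' e) {γA : ℝ} (hγA0 : 0 < γA)
    (hγA : ∀ x : Λ → ℝ, γA * ∑ e, x e ^ 2 ≤ ∑ e, ∑ e', A e e' * x e * x e')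
    {θ Jc V M V₂ M₂ V₄ : ℝ} (hθ : 0 < θ)
    (hJc : ∀ e : Λ, ∑ e' : Λ, |A e e'| * (Real.cosh (θ * Real.sqrt (∑ j, ((((e : B1Eq324BenfattoLemma.Site d) j : ℝ) - ((e' : B1Eq324BenfattoLemma.Site d) j : ℝ))) ^ 2)) - 1) ≤ Jc)
    (hJcγ : Jc < γA)
    (hV : ∀ e : Λ, ∑ e' : Λ, Real.exp (-(θ * Real.sqrt (∑ j, ((((e : B1Eq324BenfattoLemma.Site d) j : ℝ) - ((e' : B1Eq324BenfattoLemma.Site d) j : ℝ))) ^ 2))) *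
      (1 + Real.sqrt (∑ j, ((((e : B1Eq324BenfattoLemma.Site d) j : ℝ) - ((e' : B1Eq324BenfattoLemma.Site d) j : ℝ))) ^ 2)) ≤ V)
    (hM : ∀ e : Λ, ∑ e' : Λ, |A e e'| * (1 + Real.sqrt (∑ j, ((((e : B1Eq324BenfattoLemma.Site d) j : ℝ) - ((e' : B1Eq324BenfattoLemma.Site d) j : ℝ))) ^ 2)) ≤ M)
    (hV₂ : ∀ e : Λ, ∑ e' : Λ, Real.exp (-(θ / 2 * Real.sqrt (∑ j, ((((e : B1Eq324BenfattoLemma.Site d) j : ℝ) - ((e' : B1Eq324BenfattoLemma.Site d) j : ℝ))) ^ 2))) ≤ V₂)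
    (hM₂ : ∀ e : Λ, ∑ e' : Λ, |A e e'| * Real.exp (θ / 2 * Real.sqrt (∑ j, ((((e : B1Eq324BenfattoLemma.Site d) j : ℝ) - ((e' : B1Eq324BenfattoLemma.Site d) j : ℝ))) ^ 2)) ≤ M₂)
    (hV₄ : ∀ e : Λ, ∑ e' : Λ, Real.exp (-(θ / 4 * Real.sqrt (∑ j, ((((e : B1Eq324BenfattoLemma.Site d) j : ℝ) - ((e' : B1Eq324BenfattoLemma.Site d) j : ℝ))) ^ 2))) *
      (1 + Real.sqrt (∑ j, ((((e : B1Eq324BenfattoLemma.Site d) j : ℝ) - ((e' : B1Eq324BenfattoLemma.Site d) j : ℝ))) ^ 2)) ≤ V₄)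
    (hJc0 : 0 ≤ Jc) (hV0 : 0 ≤ V) (hM0 : 0 ≤ M) (hV₂0 : 0 ≤ V₂) (hM₂0 : 0 ≤ M₂) (hV₄0 : 0 ≤ V₄) (hhalf : 1 / γA ≤ 1 / 2)
    {κ : ℝ} (hκ : 0 < κ) {γ : ℝ} (hγ0 : 0 < γ) (hγ1 : γ ≤ 1) {b : ℝ} (hsmallU : M₂ * V₄ / (γA - Jc) * (γ + Real.exp (-(θ / 4 * b ^ 3))) ≤ 1 / 2)
    {D : ℕ} {δ : ℝ} (hδ : 0 < δ) (hδle : δ ≤ θ / Real.sqrt d) (hres : 0 < κ / 2 - δ / 2 * ((D : ℝ) ^ 2 * Real.sqrt d)) (t : ℕ)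
    {L w v : ℕ} (hL2 : 2 * (2 * w + v) < L) (hfit : (d + 1) * (2 * (2 * w + v)) ≤ L) (hv : v ≤ w) (hw : 1 ≤ w)
    (hb1 : 1 ≤ b) (hsmall : ((L : ℝ) ^ d) * Real.exp (-(b ^ 2 / 4)) ≤ 1 / 6)
    (hguard : Jc / (Real.cosh (θ * w) - 1) < γA) (hW1 : 1 ≤ θ * w) (hW2 : 4 * Jc / γA ≤ (θ * w) ^ 2)
    {s : ℕ} {I J : Finset (B1Eq324BenfattoLemma.Site d)} (hJI : J ⊆ I) (a : Coef d) {Ac : ℝ} (hAdef : Ac = coefSup s D a J)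
    (hpad : ∀ x ∈ J, ∀ z : B1Eq324BenfattoLemma.Site d, (∀ i, |z i - x i| < (L : ℤ)) → z ∈ Λ)
    {C : Finset (B1Eq324BenfattoLemma.Site d)} (hC0 : C ⊆ Λ)
    (hCfar0 : ∀ c ∈ C, ∀ x ∈ J, b ^ 3 + Real.sqrt d * (L : ℝ) ≤ Real.sqrt (∑ j, (((x j : ℝ) - (c j : ℝ))) ^ 2))
    (zbar : B1Eq324BenfattoLemma.Site d → ℝ)
    {S ρ₁ ρ₂ ρ₃ ρ₄ : ℝ}
    (hledger : ∀ n : ℕ, n ≤ d + 1 →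
          ∑ j ∈ Finset.range n,
          (s1Const s D d κ * Ac * (γ * (b / γ ^ (j + 1))) ^ D * Real.exp (-(κ / 4 * w)) * (I.card : ℝ)
            + s1Const s D d κ * Ac * (b / γ ^ (j + 1)) ^ D *
              (Real.exp (-(κ / 4 * w)) * ((I.card : ℝ) * (L : ℝ) ^ d) + Real.exp (-(κ / 4 * v)) * ((I.card : ℝ) * (L : ℝ) ^ d))
            + (32 * (Jc / γA) * (2 / (1 - Real.exp (-(θ / 2 / Real.sqrt d))) * Real.exp (θ / 2 / Real.sqrt d)) ^ d +
              8 * Jc * ((1 + V * M / (γA - Jc)) ^ 2) * (b / γ ^ (j + 1)) ^ 2 *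
                ((2 * (1 + Real.sqrt d * ((L : ℝ) - 1)) ^ 2 + 128 / θ ^ 2) *
                  (2 / (1 - Real.exp (-(θ / 4 / Real.sqrt d))) * Real.exp (θ / 4 / Real.sqrt d)) ^ d)) *
            ((I.card : ℝ) * (L : ℝ) ^ d) * Real.exp (-(θ * w / 2))
          + ((I.card : ℝ) *
              (2 * (2 ^ ((t + 1).choose 2) * (4 * (s1Const s D d κ * Ac * (b / γ ^ (j + 1)) ^ D * (L : ℝ) ^ d)) ^ (t + 1) / (t + 1)!) +
                    Real.exp (2 * (4 * (s1Const s D d κ * Ac * (b / γ ^ (j + 1)) ^ D * (L : ℝ) ^ d))) *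
                      (3 * ((L : ℝ) ^ d * Real.exp (-((b / γ ^ (j + 1)) ^ 2 / 4)))) +
                    ∑ k ∈ Finset.range t,
                      (3 ^ (k + 1) * ((∑ π ∈ setPartitions (univ : Finset (Fin (k + 1))), ((π.card - 1)! : ℝ)) *
                          (s1Const s D d κ * Ac * (b / γ ^ (j + 1)) ^ D * Real.exp (-(κ / 4 * v)) * (L : ℝ) ^ d *
                            (4 * (s1Const s D d κ * Ac * (b / γ ^ (j + 1)) ^ D * (L : ℝ) ^ d)) ^ k)) +
                        3 ^ (k + 1) * (2 ^ (k + 1) * ((∑ π ∈ setPartitions (univ : Finset (Fin (k + 1))), ((π.card - 1)! : ℝ)) *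
                            ((min 1 (2 * (L : ℝ) ^ d * Real.exp (-((b / γ ^ (j + 1)) ^ 2 / 4)))) ^ ((2 * (k + 1) : ℕ) : ℝ)⁻¹ *
                              ((1 + ((1 + M₂ * V₄ / (γA - Jc) * (γ + 1)) * (b / γ ^ (j + 1)))) ^ D * (Ac * (L : ℝ) ^ d * ∑ p ∈ Finset.Icc 1 s, ((admissible p D).card : ℝ) *
              ((2 / (1 - Real.exp (-(κ / 2 / (p : ℕ) / Real.sqrt d))) * Real.exp (κ / 2 / (p : ℕ) / Real.sqrt d)) ^ d) ^ (p - 1)) * momentConst D (2 * (k + 1)) (max (max 1 (1 / (γA - Jc))) ((1 + M₂ * V₄ / (γA - Jc) * (γ + 1)) * (b / γ ^ (j + 1)))).toNNReal) ^ (k + 1))) +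
                          2 ^ ((k + 1) * D) * 2 ^ 2 ^ ((k + 1) * D) * (max (max 1 (1 / (γA - Jc))) ((1 + M₂ * V₄ / (γA - Jc) * (γ + 1)) * (b / γ ^ (j + 1)))) ^ ((k + 1) * D) * Real.exp (-(δ / 2 * ((v : ℝ) + 1))) *
                            (Ac * Real.exp (δ / 2 * ((D : ℝ) ^ 2 * d)) * (L : ℝ) ^ d * ∑ p ∈ Finset.Icc 1 s, ((admissible p D).card : ℝ) *
              ((2 / (1 - Real.exp (-((κ / 2 - δ / 2 * ((D : ℝ) ^ 2 * Real.sqrt d)) / (p : ℕ) / Real.sqrt d))) *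
                Real.exp ((κ / 2 - δ / 2 * ((D : ℝ) ^ 2 * Real.sqrt d)) / (p : ℕ) / Real.sqrt d)) ^ d) ^ (p - 1)) ^ (k + 1)) +
                        3 ^ (k + 1) * (2 ^ (k + 1) * ((∑ π ∈ setPartitions (univ : Finset (Fin (k + 1))), ((π.card - 1)! : ℝ)) *
                            ((min 1 (2 * (L : ℝ) ^ d * Real.exp (-((b / γ ^ (j + 1)) ^ 2 / 4)))) ^ ((2 * (k + 1) : ℕ) : ℝ)⁻¹ *
                              ((1 + ((1 + M₂ * V₄ / (γA - Jc) * (γ + 1)) * (b / γ ^ (j + 1)))) ^ D * (Ac * (L : ℝ) ^ d * ∑ p ∈ Finset.Icc 1 s, ((admissible p D).card : ℝ) *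
              ((2 / (1 - Real.exp (-(κ / 2 / (p : ℕ) / Real.sqrt d))) * Real.exp (κ / 2 / (p : ℕ) / Real.sqrt d)) ^ d) ^ (p - 1)) * momentConst D (2 * (k + 1)) (max (max 1 (1 / (γA - Jc))) ((1 + M₂ * V₄ / (γA - Jc) * (γ + 1)) * (b / γ ^ (j + 1)))).toNNReal) ^ (k + 1))) +
                          (Ac * (L : ℝ) ^ d * ∑ p ∈ Finset.Icc 1 s, ((admissible p D).card : ℝ) *
              ((2 / (1 - Real.exp (-(κ / 2 / (p : ℕ) / Real.sqrt d))) * Real.exp (κ / 2 / (p : ℕ) / Real.sqrt d)) ^ d) ^ (p - 1)) ^ (k + 1) * (2 ^ ((k + 1) * D) * 2 ^ 2 ^ ((k + 1) * D) *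
                            ((((k + 1) * D : ℕ) : ℝ) * (max (max 1 (1 / (γA - Jc))) ((1 + M₂ * V₄ / (γA - Jc) * (γ + 1)) * (b / γ ^ (j + 1)))) ^ ((k + 1) * D) * ((V₂ * M₂ / (γA - Jc) ^ 2 * Real.exp (-(θ / 2 * ((w - v : ℕ) : ℝ))) + Real.exp (-(θ * ((w - v : ℕ) : ℝ))) / (γA - Jc)) + M₂ * V₄ / (γA - Jc) * (γ * Real.exp (-(θ / 4 * ((w - v : ℕ) : ℝ))) + Real.exp (-(θ / 4 * b ^ 3))) * (b / γ ^ (j + 1)) * (1 + Real.sqrt d * ((L : ℝ) - 1))))))) / (k + 1)!) +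
            ∑ k ∈ Finset.range t,
          ((2 ^ (k + 1) * (2 ^ ((k + 1) * D) * 2 ^ 2 ^ ((k + 1) * D) * (max (max 1 (1 / (γA - Jc))) ((1 + M₂ * V₄ / (γA - Jc) * (γ + 1)) * (b / γ ^ (j + 1)))) ^ ((k + 1) * D)) *
          ((Ac * Real.exp (δ / 2 * ((D : ℝ) ^ 2 * d)) *
              Real.exp (-((κ / 2 - δ / 2 * ((D : ℝ) ^ 2 * Real.sqrt d)) / 2 * w))) * (I.card : ℝ) *
            ∑ p ∈ Finset.Icc 1 s, ((admissible p D).card : ℝ) *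
              ((2 / (1 - Real.exp (-((κ / 2 - δ / 2 * ((D : ℝ) ^ 2 * Real.sqrt d)) / 2 / (p : ℕ) / Real.sqrt d))) *
                Real.exp ((κ / 2 - δ / 2 * ((D : ℝ) ^ 2 * Real.sqrt d)) / 2 / (p : ℕ) / Real.sqrt d)) ^ d) ^ (p - 1)) *
          (Ac * Real.exp (δ / 2 * ((D : ℝ) ^ 2 * d)) *
            ((1 : ℝ) * (2 / (1 - Real.exp (-(δ / (2 * ((k + 1 : ℕ) : ℝ)) / Real.sqrt d))) * Real.exp (δ / (2 * ((k + 1 : ℕ) : ℝ)) / Real.sqrt d)) ^ d) *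
            ∑ p ∈ Finset.Icc 1 s, ((admissible p D).card : ℝ) *
              ((2 / (1 - Real.exp (-((κ / 2 - δ / 2 * ((D : ℝ) ^ 2 * Real.sqrt d)) / (p : ℕ) / Real.sqrt d))) *
                Real.exp ((κ / 2 - δ / 2 * ((D : ℝ) ^ 2 * Real.sqrt d)) / (p : ℕ) / Real.sqrt d)) ^ d) ^ (p - 1)) ^ k
          + 2 ^ (k + 1) * (2 ^ ((k + 1) * D) * 2 ^ 2 ^ ((k + 1) * D) * (max (max 1 (1 / (γA - Jc))) ((1 + M₂ * V₄ / (γA - Jc) * (γ + 1)) * (b / γ ^ (j + 1)))) ^ ((k + 1) * D)) *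
        ((I.card : ℝ) * (Ac * Real.exp (δ / 2 * ((D : ℝ) ^ 2 * d)) * Real.exp (-((κ / 2 - δ / 2 * ((D : ℝ) ^ 2 * Real.sqrt d)) / 2 * v)) *
          (L : ℝ) ^ d * ∑ p ∈ Finset.Icc 1 s, ((admissible p D).card : ℝ) *
              ((2 / (1 - Real.exp (-((κ / 2 - δ / 2 * ((D : ℝ) ^ 2 * Real.sqrt d)) / 2 / (p : ℕ) / Real.sqrt d))) *
                Real.exp ((κ / 2 - δ / 2 * ((D : ℝ) ^ 2 * Real.sqrt d)) / 2 / (p : ℕ) / Real.sqrt d)) ^ d) ^ (p - 1))) *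
        (Ac * Real.exp (δ / 2 * ((D : ℝ) ^ 2 * d)) *
          (2 / (1 - Real.exp (-(δ / (2 * ((k + 1 : ℕ) : ℝ)) / Real.sqrt d))) * Real.exp (δ / (2 * ((k + 1 : ℕ) : ℝ)) / Real.sqrt d)) ^ d *
          ∑ p ∈ Finset.Icc 1 s, ((admissible p D).card : ℝ) *
              ((2 / (1 - Real.exp (-((κ / 2 - δ / 2 * ((D : ℝ) ^ 2 * Real.sqrt d)) / (p : ℕ) / Real.sqrt d))) *
                Real.exp ((κ / 2 - δ / 2 * ((D : ℝ) ^ 2 * Real.sqrt d)) / (p : ℕ) / Real.sqrt d)) ^ d) ^ (p - 1)) ^ k)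
          + (2 ^ (k + 1) * (2 ^ ((k + 1) * D) * 2 ^ 2 ^ ((k + 1) * D) * (max (max 1 (1 / (γA - Jc))) ((1 + M₂ * V₄ / (γA - Jc) * (γ + 1)) * (b / γ ^ (j + 1)))) ^ ((k + 1) * D)) *
          (Ac * Real.exp (δ / 2 * ((D : ℝ) ^ 2 * d)) * Real.exp (-((κ / 2 - δ / 2 * ((D : ℝ) ^ 2 * Real.sqrt d)) / 2 * w)) *
            ((I.card : ℝ) * (L : ℝ) ^ d) * ∑ p ∈ Finset.Icc 1 s, ((admissible p D).card : ℝ) *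
              ((2 / (1 - Real.exp (-((κ / 2 - δ / 2 * ((D : ℝ) ^ 2 * Real.sqrt d)) / 2 / (p : ℕ) / Real.sqrt d))) *
                Real.exp ((κ / 2 - δ / 2 * ((D : ℝ) ^ 2 * Real.sqrt d)) / 2 / (p : ℕ) / Real.sqrt d)) ^ d) ^ (p - 1)) *
          (Ac * Real.exp (δ / 2 * ((D : ℝ) ^ 2 * d)) *
            (2 / (1 - Real.exp (-(δ / (2 * ((k + 1 : ℕ) : ℝ)) / Real.sqrt d))) * Real.exp (δ / (2 * ((k + 1 : ℕ) : ℝ)) / Real.sqrt d)) ^ d *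
            ∑ p ∈ Finset.Icc 1 s, ((admissible p D).card : ℝ) *
              ((2 / (1 - Real.exp (-((κ / 2 - δ / 2 * ((D : ℝ) ^ 2 * Real.sqrt d)) / (p : ℕ) / Real.sqrt d))) *
                Real.exp ((κ / 2 - δ / 2 * ((D : ℝ) ^ 2 * Real.sqrt d)) / (p : ℕ) / Real.sqrt d)) ^ d) ^ (p - 1)) ^ k
          + 2 ^ (k + 1) * (2 ^ ((k + 1) * D) * 2 ^ 2 ^ ((k + 1) * D) * (max (max 1 (1 / (γA - Jc))) ((1 + M₂ * V₄ / (γA - Jc) * (γ + 1)) * (b / γ ^ (j + 1)))) ^ ((k + 1) * D)) *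
        ((I.card : ℝ) * (Ac * Real.exp (δ / 2 * ((D : ℝ) ^ 2 * d)) * Real.exp (-((κ / 2 - δ / 2 * ((D : ℝ) ^ 2 * Real.sqrt d)) / 2 * v)) *
          (L : ℝ) ^ d * ∑ p ∈ Finset.Icc 1 s, ((admissible p D).card : ℝ) *
              ((2 / (1 - Real.exp (-((κ / 2 - δ / 2 * ((D : ℝ) ^ 2 * Real.sqrt d)) / 2 / (p : ℕ) / Real.sqrt d))) *
                Real.exp ((κ / 2 - δ / 2 * ((D : ℝ) ^ 2 * Real.sqrt d)) / 2 / (p : ℕ) / Real.sqrt d)) ^ d) ^ (p - 1))) *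
        (Ac * Real.exp (δ / 2 * ((D : ℝ) ^ 2 * d)) *
          (2 / (1 - Real.exp (-(δ / (2 * ((k + 1 : ℕ) : ℝ)) / Real.sqrt d))) * Real.exp (δ / (2 * ((k + 1 : ℕ) : ℝ)) / Real.sqrt d)) ^ d *
          ∑ p ∈ Finset.Icc 1 s, ((admissible p D).card : ℝ) *
              ((2 / (1 - Real.exp (-((κ / 2 - δ / 2 * ((D : ℝ) ^ 2 * Real.sqrt d)) / (p : ℕ) / Real.sqrt d))) *
                Real.exp ((κ / 2 - δ / 2 * ((D : ℝ) ^ 2 * Real.sqrt d)) / (p : ℕ) / Real.sqrt d)) ^ d) ^ (p - 1)) ^ k)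
          + 2 ^ ((k + 1) * D) * 2 ^ 2 ^ ((k + 1) * D) * (max (max 1 (1 / (γA - Jc))) ((1 + M₂ * V₄ / (γA - Jc) * (γ + 1)) * (b / γ ^ (j + 1)))) ^ ((k + 1) * D) *
        ((I.card : ℝ) * (((k + 1 : ℕ) : ℝ) * (k : ℝ) *
          ((Ac * Real.exp (δ / 2 * ((D : ℝ) ^ 2 * d)) * ((L : ℝ) ^ d * (2 / (1 - Real.exp (-(δ / (2 * ((k + 1 : ℕ) : ℝ)) / Real.sqrt d))) * Real.exp (δ / (2 * ((k + 1 : ℕ) : ℝ)) / Real.sqrt d)) ^ d) *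
              ∑ p ∈ Finset.Icc 1 s, ((admissible p D).card : ℝ) *
              ((2 / (1 - Real.exp (-((κ / 2 - δ / 2 * ((D : ℝ) ^ 2 * Real.sqrt d)) / (p : ℕ) / Real.sqrt d))) *
                Real.exp ((κ / 2 - δ / 2 * ((D : ℝ) ^ 2 * Real.sqrt d)) / (p : ℕ) / Real.sqrt d)) ^ d) ^ (p - 1)) * ((Ac * Real.exp (δ / 2 * ((D : ℝ) ^ 2 * d)) * Real.exp (-(δ / (2 * ((k + 1 : ℕ) : ℝ)) / 2 * ((w : ℝ) + v + 1))) * ((L : ℝ) ^ d * (2 / (1 - Real.exp (-(δ / (2 * ((k + 1 : ℕ) : ℝ)) / 2 / Real.sqrt d))) * Real.exp (δ / (2 * ((k + 1 : ℕ) : ℝ)) / 2 / Real.sqrt d)) ^ d) *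
              ∑ p ∈ Finset.Icc 1 s, ((admissible p D).card : ℝ) *
              ((2 / (1 - Real.exp (-((κ / 2 - δ / 2 * ((D : ℝ) ^ 2 * Real.sqrt d)) / (p : ℕ) / Real.sqrt d))) *
                Real.exp ((κ / 2 - δ / 2 * ((D : ℝ) ^ 2 * Real.sqrt d)) / (p : ℕ) / Real.sqrt d)) ^ d) ^ (p - 1)) *
             (Ac * Real.exp (δ / 2 * ((D : ℝ) ^ 2 * d)) * ((L : ℝ) ^ d * (2 / (1 - Real.exp (-(δ / (2 * ((k + 1 : ℕ) : ℝ)) / Real.sqrt d))) * Real.exp (δ / (2 * ((k + 1 : ℕ) : ℝ)) / Real.sqrt d)) ^ d) *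
              ∑ p ∈ Finset.Icc 1 s, ((admissible p D).card : ℝ) *
              ((2 / (1 - Real.exp (-((κ / 2 - δ / 2 * ((D : ℝ) ^ 2 * Real.sqrt d)) / (p : ℕ) / Real.sqrt d))) *
                Real.exp ((κ / 2 - δ / 2 * ((D : ℝ) ^ 2 * Real.sqrt d)) / (p : ℕ) / Real.sqrt d)) ^ d) ^ (p - 1)) ^ (k - 1)))))
          + (I.card : ℝ) * ((3 : ℝ) ^ (k + 1) *
        (2 ^ ((k + 1) * D) * 2 ^ 2 ^ ((k + 1) * D) * (max (max 1 (1 / (γA - Jc))) ((1 + M₂ * V₄ / (γA - Jc) * (γ + 1)) * (b / γ ^ (j + 1)))) ^ ((k + 1) * D) *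
            Real.exp (-(δ / 2 * ((v : ℝ) + 1))) *
          (Ac * Real.exp (δ / 2 * ((D : ℝ) ^ 2 * d)) * (L : ℝ) ^ d * ∑ p ∈ Finset.Icc 1 s, ((admissible p D).card : ℝ) *
              ((2 / (1 - Real.exp (-((κ / 2 - δ / 2 * ((D : ℝ) ^ 2 * Real.sqrt d)) / (p : ℕ) / Real.sqrt d))) *
                Real.exp ((κ / 2 - δ / 2 * ((D : ℝ) ^ 2 * Real.sqrt d)) / (p : ℕ) / Real.sqrt d)) ^ d) ^ (p - 1)) ^ (k + 1)))) / (k + 1)!))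
            ≤ (I.card : ℝ) * errTerm S ρ₁ ρ₂ ρ₃ ρ₄ Ac b t) :
    ∫ z, cutoffBoltzmann (hamiltonian s D κ a J) I b z ∂((gaussianFieldOfKernel (condCov K C)).map
        fun (ζ' : B1Eq324BenfattoLemma.Site d → ℝ) (x : B1Eq324BenfattoLemma.Site d) => condMean K C zbar x + ζ' x) ≤
      Real.exp (cumulantSum (gaussianFieldOfKernel K) (hamiltonian s D κ a J) t + (I.card : ℝ) * errTerm S ρ₁ ρ₂ ρ₃ ρ₄ Ac b t) := by
  classical
  -- §0 scalars
  have hL : 0 < L := by omega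
  have hw' : 0 < w := hw
  have hL1 : (1 : ℝ) ≤ (L : ℝ) := by exact_mod_cast hL
  have hγ0' : 0 ≤ γ := hγ0.le
  have hb0 : 0 < b := lt_of_lt_of_le one_pos hb1
  have hAc0 : 0 ≤ Ac := by rw [hAdef]; exact coefSup_nonneg s D a J
  have hκ'0 : 0 ≤ κ / 2 - δ / 2 * ((D : ℝ) ^ 2 * Real.sqrt d) := hres.le
  have hR : (0 : ℝ) < b ^ 3 := by positivity
  -- §1 the coefficient clipped to `J` (same Hamiltonian)
  obtain ⟨a', ha'J, ha'A, -, ha'H⟩ := exists_coefSupportedIn_clip s D a J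
  have ha'Ac : ∀ (p : ℕ) (Δ : Fin p → B1Eq324BenfattoLemma.Site d) (nn : Fin p → ℕ), |a' p Δ nn| ≤ Ac := by
    rw [hAdef]; exact ha'A
  -- §2 the chain data (constant diagonal displacements; growing cut-offs; drifting conditioning data)
  set c : ℕ := 2 * (2 * w + v) with hc
  let τ : ℕ → B1Eq324BenfattoLemma.Site d := fun (_ : ℕ) (_ : Fin d) => -(c : ℤ)
  let Js : ℕ → Finset (B1Eq324BenfattoLemma.Site d) := fun k => Nat.rec (motive := fun _ => Finset (B1Eq324BenfattoLemma.Site d)) J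
    (fun k Jk => Jk.image (fun x => x + τ k) ∩ corridorsBar L w v ((Jk.image fun x => x + τ k).image (boxIndex L))) k
  let as : ℕ → Coef d := fun k => Nat.rec (motive := fun _ => Coef d) a'
    (fun k ak => restrictCoef (shiftCoef ak (-τ k)) (corridorsBar L w v (((Js k).image fun x => x + τ k).image (boxIndex L)))) k
  let Is : ℕ → Finset (B1Eq324BenfattoLemma.Site d) := fun k => Nat.rec (motive := fun _ => Finset (B1Eq324BenfattoLemma.Site d)) I
    (fun k Ik => Ik.image fun x => x + τ k) k
  let Cs : ℕ → Finset (B1Eq324BenfattoLemma.Site d) := fun k => Nat.rec (motive := fun _ => Finset (B1Eq324BenfattoLemma.Site d)) C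
    (fun k Ck => Ck.image fun x => x + τ k) k
  let zs : ℕ → B1Eq324BenfattoLemma.Site d → ℝ := fun k => Nat.rec (motive := fun _ => B1Eq324BenfattoLemma.Site d → ℝ) zbar
    (fun k zk => fun y => zk (y - τ k)) k
  let bs : ℕ → ℝ := fun k => b / γ ^ (k + 1)
  let σ : ℕ → B1Eq324BenfattoLemma.Site d := fun k => Nat.rec (motive := fun _ => B1Eq324BenfattoLemma.Site d) 0 (fun k σk => σk - τ k) k
  have hrecJ : ∀ k < d + 1, Js (k + 1) = (Js k).image (fun x => x + τ k) ∩
      corridorsBar L w v (((Js k).image fun x => x + τ k).image (boxIndex L)) := fun k _ => rfl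
  have hbs : ∀ k, bs k = b / γ ^ (k + 1) := fun k => rfl
  have hbk : ∀ k, b ≤ bs k := fun k => by
    rw [hbs, le_div_iff₀ (pow_pos hγ0 _)]
    exact mul_le_of_le_one_right hb0.le (pow_le_one₀ hγ0' hγ1)
  -- §3 the stopping index (n08-d) from the separation of the constant diagonal displacements
  have hsep : ∀ j j' : Fin (d + 1), j ≠ j' → ∀ (i : Fin d) (q : ℤ),
      (2 * (2 * w + v : ℕ) : ℤ) ≤ |(-(∑ i' ∈ Finset.range ((j : ℕ) + 1), τ i')) i - (-(∑ i' ∈ Finset.range ((j' : ℕ) + 1), τ i')) i - q * L| := by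
    intro j j' hjj' i q
    have h := sep_of_constDiagonal (d := d) hfit j j' hjj' i q
    push_cast at h ⊢
    exact h
  obtain ⟨m, hm, hJm, hJne⟩ := exists_stoppingIndex (L := L) (w := w) (v := v) (Js := Js)
    (Bs := fun k => ((Js k).image fun x => x + τ k).image (boxIndex L)) (τ := τ) hL hrecJ hsep
  -- the recursions along the first `m` steps
  have hrecJm : ∀ k < m, Js (k + 1) = (Js k).image (fun x => x + τ k) ∩
      corridorsBar L w v (((Js k).image fun x => x + τ k).image (boxIndex L)) := fun k _ => rfl
  have hrecIm : ∀ k < m, Is (k + 1) = (Is k).image fun x => x + τ k := fun k _ => rfl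
  have hrecam : ∀ k < m, as (k + 1) = restrictCoef (shiftCoef (as k) (-τ k))
      (corridorsBar L w v (((Js k).image fun x => x + τ k).image (boxIndex L))) := fun k _ => rfl
  have hrecCm : ∀ k < m, Cs (k + 1) = (Cs k).image fun x => x + τ k := fun k _ => rfl
  have hreczm : ∀ k < m, zs (k + 1) = fun y => zs k (y - τ k) := fun k _ => rfl
  have hrecbm : ∀ k < m, γ * bs (k + 1) = bs k := fun k _ => by
    rw [hbs, hbs, pow_succ]
    field_simp
  have hσ0 : σ 0 = 0 := rfl
  have hrecσm : ∀ k < m, σ (k + 1) = σ k - τ k := fun k _ => rfl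
  have hbm : ∀ k < m, 1 ≤ bs k := fun k _ => hb1.trans (hbk k)
  have hγbm : ∀ k < m, 1 ≤ γ * bs k := fun k _ => by
    have h : γ * bs k = b / γ ^ k := by
      rw [hbs, pow_succ]
      field_simp
    rw [h, le_div_iff₀ (pow_pos hγ0 _), one_mul]
    exact (pow_le_one₀ hγ0' hγ1).trans hb1
  have hsmm : ∀ k < m, ((L : ℝ) ^ d) * Real.exp (-(bs k ^ 2 / 4)) ≤ 1 / 6 := fun k _ => by
    refine le_trans (mul_le_mul_of_nonneg_left (Real.exp_le_exp.mpr ?_) (by positivity)) hsmall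
    have h1 : b ≤ bs k := hbk k
    nlinarith [mul_le_mul h1 h1 hb0.le (hb0.le.trans h1)]
  have hb0m : ∀ k < m, 0 ≤ bs k := fun k hk => zero_le_one.trans (hbm k hk)
  -- §4 frames, conditioning sets, parts and far rows inside the frames (from the padding of `J` and the far hypothesis on `C`)
  have hBΛ := boxes_subset_frame_of_pad (Λ := Λ) (Js := Js) (n := m)
    (Bs := fun k => ((Js k).image fun x => x + τ k).image (boxIndex L)) hL hrecJm hσ0 hrecσm hpad
  have hΓΛ := corridors_subset_frame_of_pad (Λ := Λ) (Js := Js) (n := m)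
    (Bs := fun k => ((Js k).image fun x => x + τ k).image (boxIndex L)) hL hrecJm hσ0 hrecσm hpad
  have hCΛ := conditioning_subset_frame (Λ := Λ) (Cs := Cs) (n := m) hrecCm hσ0 hrecσm hC0
  have hCsh := disjoint_shrink_conditioning_of_far (L := L) (w := w) (v := v) (Js := Js) (Cs := Cs) (n := m)
    (Bs := fun k => ((Js k).image fun x => x + τ k).image (boxIndex L)) hL hrecJm hrecCm hσ0 hrecσm hR hCfar0
  have hCfar := far_conditioning_of_far (L := L) (w := w) (v := v) (Js := Js) (Cs := Cs) (n := m)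
    (Bs := fun k => ((Js k).image fun x => x + τ k).image (boxIndex L)) hL hrecJm hrecCm hσ0 hrecσm hCfar0
  -- §5 the part kernels, by definition (standard currency)
  let Kbs : ℕ → B1Eq324BenfattoLemma.Site d → B1Eq324BenfattoLemma.Site d → B1Eq324BenfattoLemma.Site d → ℝ := fun k mm x y =>
    if hkm : k < m ∧ mm ∈ ((Js k).image fun x => x + τ k).image (boxIndex L) then
      if h : x ∈ shrink L mm w ∧ y ∈ shrink L mm w then
        (((A.submatrix (fun j : ↥(Λ.image fun y => y - σ (k + 1)) => (⟨(j : B1Eq324BenfattoLemma.Site d) + σ (k + 1), (mem_image_sub_iff (σ (k + 1))).mp j.2⟩ : Λ))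
            (fun j : ↥(Λ.image fun y => y - σ (k + 1)) => (⟨(j : B1Eq324BenfattoLemma.Site d) + σ (k + 1), (mem_image_sub_iff (σ (k + 1))).mp j.2⟩ : Λ))).submatrix
            (fun j : ↥(shrink L mm w) => (⟨j, hBΛ k hkm.1 mm hkm.2 (shrink_subset_box L mm w j.2)⟩ : ↥(Λ.image fun y => y - σ (k + 1))))
            (fun j : ↥(shrink L mm w) => (⟨j, hBΛ k hkm.1 mm hkm.2 (shrink_subset_box L mm w j.2)⟩ : ↥(Λ.image fun y => y - σ (k + 1)))))⁻¹ :
            Matrix ↥(shrink L mm w) ↥(shrink L mm w) ℝ) ⟨x, h.1⟩ ⟨y, h.2⟩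
      else 0
    else 0
  have hKbs : ∀ k (hk : k < m) mm (hmm : mm ∈ (((Js k).image fun x => x + τ k).image (boxIndex L))) x y, Kbs k mm x y =
      if h : x ∈ shrink L mm w ∧ y ∈ shrink L mm w then
      (((A.submatrix (fun j : ↥(Λ.image fun y => y - σ (k + 1)) => (⟨(j : B1Eq324BenfattoLemma.Site d) + σ (k + 1), (mem_image_sub_iff (σ (k + 1))).mp j.2⟩ : Λ))
          (fun j : ↥(Λ.image fun y => y - σ (k + 1)) => (⟨(j : B1Eq324BenfattoLemma.Site d) + σ (k + 1), (mem_image_sub_iff (σ (k + 1))).mp j.2⟩ : Λ))).submatrix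
          (fun j : ↥(shrink L mm w) => (⟨j, hBΛ k hk mm hmm (shrink_subset_box L mm w j.2)⟩ : ↥(Λ.image fun y => y - σ (k + 1))))
          (fun j : ↥(shrink L mm w) => (⟨j, hBΛ k hk mm hmm (shrink_subset_box L mm w j.2)⟩ : ↥(Λ.image fun y => y - σ (k + 1)))))⁻¹ :
          Matrix ↥(shrink L mm w) ↥(shrink L mm w) ℝ) ⟨x, h.1⟩ ⟨y, h.2⟩ else 0 := by
    intro k hk mm hmm x y
    exact dif_pos (And.intro hk hmm)
  -- §6 the upper letters at the explicit choices (far radius `R = b³`)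
  let Ku : ℕ → ℝ := fun k => (1 + M₂ * V₄ / (γA - Jc) * (γ + 1)) * bs k
  let K₀ : ℕ → ℝ := fun k => max (max 1 (1 / (γA - Jc))) (Ku k)
  let ε₃₁ : ℕ → ℝ := fun k =>
    (V₂ * M₂ / (γA - Jc) ^ 2 * Real.exp (-(θ / 2 * ((w - v : ℕ) : ℝ))) + Real.exp (-(θ * ((w - v : ℕ) : ℝ))) / (γA - Jc)) +
      M₂ * V₄ / (γA - Jc) * (γ * Real.exp (-(θ / 4 * ((w - v : ℕ) : ℝ))) + Real.exp (-(θ / 4 * b ^ 3))) * bs k * (1 + Real.sqrt d * ((L : ℝ) - 1))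
  have hgap : 0 < γA - Jc := sub_pos.mpr hJcγ
  have hgl0 : 0 ≤ 1 + Real.sqrt d * ((L : ℝ) - 1) := by
    have : 0 ≤ Real.sqrt d * ((L : ℝ) - 1) := mul_nonneg (Real.sqrt_nonneg _) (by linarith)
    linarith
  have hKuI : ∀ k < m, (1 + M₂ * V₄ / (γA - Jc) * (γ + 1)) * bs k ≤ Ku k := fun _ _ => le_rfl
  have hKuK : ∀ k < m, Ku k ≤ K₀ k := fun k _ => (K0_ties (Ku k) (1 / (γA - Jc))).2.2
  have hK₀ : ∀ k < m, 1 / (γA - Jc) ≤ K₀ k := fun k _ => (K0_ties (Ku k) (1 / (γA - Jc))).2.1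
  have hK₀1 : ∀ k < m, 1 ≤ K₀ k := fun k _ => (K0_ties (Ku k) (1 / (γA - Jc))).1
  have hε₁ : ∀ k < m, V₂ * M₂ / (γA - Jc) ^ 2 * Real.exp (-(θ / 2 * ((w - v : ℕ) : ℝ))) +
      Real.exp (-(θ * ((w - v : ℕ) : ℝ))) / (γA - Jc) ≤ ε₃₁ k := fun k hk =>
    le_add_of_nonneg_right (mul_nonneg (mul_nonneg (mul_nonneg (div_nonneg (mul_nonneg hM₂0 hV₄0) hgap.le)
      (add_nonneg (mul_nonneg hγ0' (Real.exp_pos _).le) (Real.exp_pos _).le)) (hb0m k hk)) hgl0)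
  have hε₂ : ∀ k < m, M₂ * V₄ / (γA - Jc) * (γ * Real.exp (-(θ / 4 * ((w - v : ℕ) : ℝ))) + Real.exp (-(θ / 4 * b ^ 3))) * bs k *
      (1 + Real.sqrt d * ((L : ℝ) - 1)) ≤ ε₃₁ k := fun k _ =>
    le_add_of_nonneg_left (add_nonneg (by positivity) (div_nonneg (Real.exp_pos _).le hgap.le))
  -- §7 invariants and counts along the chain
  have hinv := chain_invariants (L := L) (w := w) (v := v) (n := m)
    (Bs := fun k => ((Js k).image fun x => x + τ k).image (boxIndex L)) ha'J ha'Ac hJI hrecJm hrecIm hrecam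
  have hJIk : ∀ k < m, Js k ⊆ Is k := fun k hk => (hinv k hk.le).2.2.1
  have hJcard : ∀ k < m, ((Js k).card : ℝ) ≤ (I.card : ℝ) := fun k hk => by
    exact_mod_cast (card_chain_le (Bs := fun k => ((Js k).image fun x => x + τ k).image (boxIndex L)) hrecJm k hk.le).trans
      (Finset.card_le_card hJI)
  -- §8 the knit's ledger from the pack's clause at the stopping index, through n08-b's upper bridge
  have hgeom := ledger_geometric_le_nI_upper (Λ := Λ) (Js := Js) (Is := Is) (Cs := Cs) (τ := τ) (σ := σ) (bs := bs) (m := m) (s := s)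
    (D := D) (t := t) (R := b ^ 3) (E := (I.card : ℝ) * errTerm S ρ₁ ρ₂ ρ₃ ρ₄ Ac b t)
    hκ.le hδ.le hκ'0 hAc0 hθ hJc0 hγA0 hJcγ hV0 hM0 hV₂0 hM₂0 hV₄0 hγ0' hb0m hL hL1 hw' hW1 hW2 hJne hJIk hJcard
    (by simp only [hbs]; exact hledger m hm)
  -- §9 the class (4.6) knit at the stopping index
  have h18 := integral_condFieldK_le_exp_cumulantSum_add_of_ledger hK hΛ hAs hγA0 hγA hθ hJc hJcγ hV hM hV₂ hM₂ hV₄ hguard hκ hL2 hw' hv hγ0' hγ1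
    hAc0 (Js := Js) (Is := Is) (Cs := Cs) (as := as) (zs := zs) (bs := bs) (τ := τ) (σ := σ) (n := m) ha'J ha'Ac hJI hC0 hrecJm hrecIm hrecam
    hrecCm hreczm hrecbm hbm hγbm hsmm hσ0 hrecσm hCΛ hΓΛ hBΛ (Kbs := Kbs) hKbs hCsh hCfar (Ku := Ku) (K₀ := K₀) (ε₃₁ := ε₃₁) hKuI hKuK hK₀
    hK₀1 hε₁ hε₂ hhalf hsmallU hδ hδle hres t hJm hgeom
  -- §10 back to the data (`as 0 ≡ a'`, `Js 0 ≡ J`, `Is 0 ≡ I`, `Cs 0 ≡ C`, `zs 0 ≡ z̄` by `Nat.rec`; `γ·bs 0 = b`; the clipped Hamiltonian is the original one)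
  have hH : hamiltonian s D κ a' J = hamiltonian s D κ a J := funext fun z => ha'H κ J (Finset.Subset.refl J) z
  have hγb0 : γ * bs 0 = b := by
    rw [hbs, zero_add, pow_one, mul_div_cancel₀ _ hγ0.ne']
  rw [← hH]
  have h18' : ∫ z, cutoffBoltzmann (hamiltonian s D κ (as 0) (Js 0)) (Is 0) (γ * bs 0) z
          ∂((gaussianFieldOfKernel (condCov K (Cs 0))).map
          fun (ζ' : B1Eq324BenfattoLemma.Site d → ℝ) (x : B1Eq324BenfattoLemma.Site d) => condMean K (Cs 0) (zs 0) x + ζ' x) ≤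
      Real.exp (cumulantSum (gaussianFieldOfKernel K) (hamiltonian s D κ (as 0) (Js 0)) t + (I.card : ℝ) * errTerm S ρ₁ ρ₂ ρ₃ ρ₄ Ac b t) := h18
  rw [hγb0] at h18'
  exact h18'

end Member

end Literature.MathematicalPhysics.QuantumFieldTheory.Balaban1983to89.B1Eq324BenfattoKernelSect5Ineq46Class

end
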